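import Mathlib

/-!
# SoloBlind — hump counting on the quartic window (kernel #130)

The logical step of the (C5) global-max margin certificate of the corner carrier
(paper §24.83–24.84; kit job j324930): on the window where the fourth `c`-derivative of the
leaf exponent `σ` is negative, `σ' = g` has negative third derivative, hence at most three
zeros — at most three critical leaves, i.e. at most two humps; on the annulus where `σ'` is
signed, `σ` is strictly monotone (no critical leaf).  Pure real analysis: Rolle iterated.
-/

namespace Summit.AnomalousDissipation.AnomalousDissipation.Theorems

open Set

/-- Rolle step on a sub-interval: if `g` has derivative `g'` at every point of `[a,b]` and
vanishes at two points `x < y` of `[a,b]`, then `g'` vanishes somewhere in `(x,y)`. -/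
theorem rolle_step_Icc {g g' : ℝ → ℝ} {a b x y : ℝ}
    (hg : ∀ t ∈ Icc a b, HasDerivAt g (g' t) t) (hx : a ≤ x) (hxy : x < y) (hy : y ≤ b)
    (gx : g x = 0) (gy : g y = 0) : ∃ z ∈ Ioo x y, g' z = 0 := by
  have hcont : ContinuousOn g (Icc x y) := fun t ht =>
    (hg t ⟨le_trans hx ht.1, le_trans ht.2 hy⟩).continuousAt.continuousWithinAt
  exact exists_hasDerivAt_eq_zero hxy hcont (by rw [gx, gy])
    (fun t ht => hg t ⟨le_trans hx ht.1.le, le_trans ht.2.le hy⟩)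

/-- **At most three critical leaves on the quartic window.**  If `g` (read: `σ'`) has
derivatives `g1, g2, g3` on `[a,b]` in the `HasDerivAt` sense and `g3 < 0` there
(read: `σ⁗ < 0`, the certified W4 rows), then `g` does not have four distinct zeros in `[a,b]`.
Consequently `σ` has at most three critical points and at most two local maxima (two humps)
on the window. -/
theorem at_most_three_zeros_of_third_deriv_neg {g g1 g2 g3 : ℝ → ℝ} {a b : ℝ}
    (h1 : ∀ t ∈ Icc a b, HasDerivAt g (g1 t) t) (h2 : ∀ t ∈ Icc a b, HasDerivAt g1 (g2 t) t)
    (h3 : ∀ t ∈ Icc a b, HasDerivAt g2 (g3 t) t) (hneg : ∀ t ∈ Icc a b, g3 t < 0) :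
    ¬ ∃ x₁ x₂ x₃ x₄ : ℝ, a ≤ x₁ ∧ x₁ < x₂ ∧ x₂ < x₃ ∧ x₃ < x₄ ∧ x₄ ≤ b ∧
      g x₁ = 0 ∧ g x₂ = 0 ∧ g x₃ = 0 ∧ g x₄ = 0 := by
  rintro ⟨x₁, x₂, x₃, x₄, ha1, h12, h23, h34, h4b, z1, z2, z3, z4⟩
  -- three zeros of g1
  obtain ⟨y₁, hy₁, e₁⟩ := rolle_step_Icc h1 ha1 h12 (by linarith) z1 z2
  obtain ⟨y₂, hy₂, e₂⟩ := rolle_step_Icc h1 (by linarith) h23 (by linarith) z2 z3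
  obtain ⟨y₃, hy₃, e₃⟩ := rolle_step_Icc h1 (by linarith) h34 h4b z3 z4
  -- two zeros of g2
  obtain ⟨w₁, hw₁, d₁⟩ := rolle_step_Icc h2 (by linarith [hy₁.1]) (by linarith [hy₁.2, hy₂.1])
    (by linarith [hy₂.2]) e₁ e₂
  obtain ⟨w₂, hw₂, d₂⟩ := rolle_step_Icc h2 (by linarith [hy₂.1]) (by linarith [hy₂.2, hy₃.1])
    (by linarith [hy₃.2]) e₂ e₃
  -- one zero of g3: contradiction
  obtain ⟨v, hv, c⟩ := rolle_step_Icc h3 (by linarith [hw₁.1, hy₁.1]) (by linarith [hw₁.2, hw₂.1])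
    (by linarith [hw₂.2, hy₃.2]) d₁ d₂
  have hv' : v ∈ Icc a b := ⟨by linarith [hv.1, hw₁.1, hy₁.1], by linarith [hv.2, hw₂.2, hy₃.2]⟩
  have := hneg v hv'
  rw [c] at this
  exact lt_irrefl 0 this

/-- **No critical leaf on the annulus (increasing side).**  A signed first derivative on
`[a,b]` (the certified ANN rows `σ_c > 0` left of the window) makes `σ` strictly increasing
there. -/
theorem strictMonoOn_Icc_of_hasDerivAt_pos {f f1 : ℝ → ℝ} {a b : ℝ}
    (h0 : ∀ t ∈ Icc a b, HasDerivAt f (f1 t) t) (hpos : ∀ t ∈ Icc a b, 0 < f1 t) :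
    StrictMonoOn f (Icc a b) := by
  refine strictMonoOn_of_deriv_pos (convex_Icc a b)
    (fun t ht => (h0 t ht).continuousAt.continuousWithinAt) ?_
  intro t ht
  rw [interior_Icc] at ht
  rw [(h0 t (Ioo_subset_Icc_self ht)).deriv]
  exact hpos t (Ioo_subset_Icc_self ht)

/-- **No critical leaf on the annulus (decreasing side).**  `σ_c < 0` right of the window
makes `σ` strictly decreasing there. -/
theorem strictAntiOn_Icc_of_hasDerivAt_neg {f f1 : ℝ → ℝ} {a b : ℝ}
    (h0 : ∀ t ∈ Icc a b, HasDerivAt f (f1 t) t) (hneg : ∀ t ∈ Icc a b, f1 t < 0) :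
    StrictAntiOn f (Icc a b) := by
  refine strictAntiOn_of_deriv_neg (convex_Icc a b)
    (fun t ht => (h0 t ht).continuousAt.continuousWithinAt) ?_
  intro t ht
  rw [interior_Icc] at ht
  rw [(h0 t (Ioo_subset_Icc_self ht)).deriv]
  exact hneg t (Ioo_subset_Icc_self ht)

/-- **Margin assembly (order logic of the certificate).**  If `σ` is bounded by `θ` on the far
set `F`, and some leaf `c₀` has `σ c₀ > θ`, then no global maximiser of `σ` lies in `F`. -/
theorem no_global_max_on_far_set {ι : Type*} {σ : ι → ℝ} {F : Set ι} {θ : ℝ} {c₀ : ι}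
    (hfar : ∀ c ∈ F, σ c ≤ θ) (hc₀ : θ < σ c₀) :
    ∀ c ∈ F, ¬ ∀ c', σ c' ≤ σ c := by
  intro c hc hmax
  have := hmax c₀
  linarith [hfar c hc]

end Summit.AnomalousDissipation.AnomalousDissipation.Theorems
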